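import Summits.BirchSwinnertonDyer.BirchSwinnertonDyer.Theorems.ThetaPartnerAtTwoSignedKatoUpToAtTwoOffTwoLocalPackageRat
import Summits.BirchSwinnertonDyer.BirchSwinnertonDyer.Theorems.ThetaPartnerAtTwoSignedKatoUpToAtTwoIwasawaInvolutionCompat
import HarnessLib

/-!
# Route `ThetaPartnerAtTwo` (TP2), crux K3 `SignedKatoDivisibilityUpToAtTwo` (item stmt-BirchSwinnertonDyer-20308),
# line `colemanrat` v5: the registered stub `stub_involChainTwo` (CHAIN^ι) — (K2^ι) → GZK → (R2^ι) → K3's local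
# form off `2`, i.e. v4's four-term road READ WITH THE IWASAWA INVOLUTION `ι : T ↦ (1+T)⁻¹ − 1`

Width seat `bsd-wall-tp2-p2x-w2` g3 (cell `bsd-wall`). HONEST FRAMING: THEOREMS ONLY — no definition, no named fact,
no instance, no `sorry`; the K3-level theorem `stub_involChainTwo` is an IMPLICATION whose three antecedents are the
other registered stubs of the line (Kato Thm. 13.4 (2) at `p = 2` print-exact, Gross–Zagier–Kolyvagin by name, the
ι-repaired localised `2`-robust package); it closes no item by itself; BSD is NOT proved by any of this.

## Why this file

The lead's convention audit (`Cruxes/SignedKatoDivisibilityUpToAtTwo/G4-CONVENTION-AUDIT.md`, seconded by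
`W3G2-READER-G4-AUDIT.md`): Kato's `I : Kato2004.IwasawaH1Data W 2 κ γ` is `Λ`-COVARIANT while the pinned Pontryagin duals
`D : SignedSelmerDualData W κ γ 1`, `Y : W.FineSelmerDualData κ γ` carry PRE-composition by `conj_γ` (the `ι`-twist of
print's contragredient module), so the Poitou–Tate map `j : P → X⁺` of the package is `ι`-SEMILINEAR and Kato's bound reads
`ℓ_𝔭(X₀) ≤ ℓ_{ι𝔭}(𝐇¹/Λs)`, `ι𝔭 = comap ι 𝔭`. v4's landed certificate (`…OffTwoLocalPackageRat`) is about the un-twisted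
package; this file re-runs its chain with the twist: `ℓ_𝔭(X⁺) ≤ ℓ_𝔭(j P) + ℓ_𝔭(X₀)`, `ℓ_𝔭(j P) = ℓ_{ι𝔭}(P/ker j) ≤
ℓ_{ι𝔭}(P/col 𝐇¹)` (semilinear transport of `lengthAt`, file `…SemilinearTransport`), `ℓ_{ι𝔭}(P/col 𝐇¹) + ℓ_{ι𝔭}(𝐇¹/Λs)
≤ ℓ_{ι𝔭}(Λ/(ι_P col s))` (v4's robust four-term lemma at `ι𝔭`), Kato at `𝔭`, the zeta bound AT `ι𝔭`, and
`ℓ_{ι𝔭}(Λ/(L♭)) = ℓ_𝔭(Λ/(ι L♭)) = ℓ_𝔭(Λ/(L♭))` by the FUNCTIONAL EQUATION of `L♭` at `2` (`ι L♭ = w_E (1+T)^{c+b} L♭`,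
tree theorem `Literature.Barriers.BirchSwinnertonDyer.exists_functionalEquation_sharp_flat_two`, in K3's currency in the
sibling files `…InvolFunctionalEquation` / `…IwasawaInvolutionCompat`).

## What is proved

* §1 `fourTerm_lengthAt_le_upTo_semilinear` (any commutative rings `R`, `S`, `σ : R ≃+* S`, primes `𝔭 = σ⁻¹𝔓`): the
  four-term inequality up to torsion by `u ∉ 𝔭`, `u' ∉ 𝔓`, for `c : H → P`, `ι : P → R` linear over `R`, `k : X → Y` over
  `S`, and an ADDITIVE `σ`-SEMILINEAR `j : P → X`: `ℓ_𝔓(X) + ℓ_𝔭(H/Rz) ≤ ℓ_𝔓(Y) + ℓ_𝔭(R/(ι c z))`.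
* §2 `stub_involChainTwo` — the registered stub VERBATIM (crux workfile `Lines/colemanrat.lean` v5). The `ι`-bookkeeping
  on primes (`height_comap_invol`, `C_mem_comap_invol_iff`) and the functional-equation step
  `ℓ_{ι𝔭}(Λ/(L♭)) = ℓ_𝔭(Λ/(L♭))` (`lengthAt_quotient_kobayashiL_comap_invol_eq`) are the sibling files
  `…IwasawaInvolutionCompat` (w3 g3) / `…InvolFunctionalEquation` (lead g4), imported.

References: [Kobayashi2003] (7.17)–(7.21), Thm. 7.3; [Kato2004Asterisque] Thm. 13.4 (2), §17.13; [MazurTateTeitelbaum1986Invent]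
Ch. I §17; [GreenbergLNM1716] §1 p. 60 and pp. 67–68; [Sprung2017] Cor. 4.14; [Bourbaki1989CommAlg] Ch. II §2.4.
-/

set_option autoImplicit false
-- the Theorems namespace of this sub repeats the summit name by design (D-0017 nested layout)
set_option linter.dupNamespace false

noncomputable section

open scoped Classical MatrixGroups ModularForm NumberField

open CongruenceSubgroup WeierstrassCurve Field IsDedekindDomain NumberField
  Literature.NumberTheory.GaloisRepresentations
  Literature.NumberTheory.EllipticCurves Literature.NumberTheory.EllipticCurves.ModularForms
  Literature.NumberTheory.EllipticCurves.Module Literature.NumberTheory.EllipticCurves.Rank1Residual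
  Literature.NumberTheory.EllipticCurves.Kobayashi2003 Literature.NumberTheory.EllipticCurves.Kato2004
  Literature.NumberTheory.EllipticCurves.Kato2004.EulerSystemValues Literature.NumberTheory.EllipticCurves.GreenbergSelmer
  ZpExtension Summit.BirchSwinnertonDyer.Rank1Residual.Supersingular
  Summit.BirchSwinnertonDyer.BirchSwinnertonDyer.Theses.ThetaPartnerAtTwo

namespace Summit.BirchSwinnertonDyer.BirchSwinnertonDyer.Theorems

namespace SignedKatoOffTwo

/-! ## §1 The four-term inequality up to torsion, with an ADDITIVE `σ`-SEMILINEAR `j` -/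

section Semilinear

variable {R : Type*} {S : Type*} [CommRing R] [CommRing S]
  {H P X Y : Type*} [AddCommGroup H] [_root_.Module R H] [AddCommGroup P] [_root_.Module R P]
  [AddCommGroup X] [_root_.Module S X] [AddCommGroup Y] [_root_.Module S Y]

/-- **The four-term inequality up to torsion, semilinear version.** Let `σ : R ≃+* S` be a ring isomorphism,
`𝔭 = σ⁻¹(𝔓)` primes, `u ∉ 𝔭`, `u' ∉ 𝔓`; `c : H → P`, `ι : P → R` linear over `R`, `k : X → Y` linear over `S`,
and `j : P → X` ADDITIVE and `σ`-SEMILINEAR (`j (r • y) = σ r • j y`). If `ker ι` and `ker c` are killed by `u`,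
`u' · j (c x) = 0` for all `x` (RECIPROCITY up to `u'`) and `u' · x ∈ j(P)` whenever `k x = 0` (COVER up to `u'`),
then for every `z ∈ H`: `ℓ_𝔓(X) + ℓ_𝔭(H/Rz) ≤ ℓ_𝔓(Y) + ℓ_𝔭(R/(ι(c z)))`. Steps: (A) `ℓ_𝔓(X) ≤ ℓ_𝔓(j P) + ℓ_𝔓(Y)`;
(B) `ℓ_𝔓(j P) = ℓ_𝔭(P/ker j)` — TRANSPORT of `lengthAt` along the `σ`-semilinear `P/ker j ≃ j P`
(`SemilinearTransport.lengthAt_eq`) — `≤ ℓ_𝔭(P/range c)` as `σ⁻¹(u') · range c ⊆ ker j`; (C)+(D)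
`ℓ_𝔭(P/range c) + ℓ_𝔭(H/Rz) ≤ ℓ_𝔭(R/(ι c z))` is `fourTerm_lengthAt_le_upTo` with `X := P/range c`, `Y := 0`.
With `σ = 1`, `u = u'` this is `fourTerm_lengthAt_le_upTo`. [cite: Kato2004Asterisque, §17.13 (p. 280)]
[cite: Kobayashi2003, (7.17)–(7.21) and proof of Thm. 7.4 (pp. 12–13)] [cite: Bourbaki1989CommAlg, Ch. II §2.4] -/
theorem fourTerm_lengthAt_le_upTo_semilinear (σ : R ≃+* S) {𝔭 : PrimeSpectrum R} {𝔓 : PrimeSpectrum S}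
    (h𝔭 : 𝔭.asIdeal = 𝔓.asIdeal.comap σ) (ι : P →ₗ[R] R) (c : H →ₗ[R] P) (j : P →+ X)
    (hj : ∀ (r : R) (y : P), j (r • y) = σ r • j y) (k : X →ₗ[S] Y) {u : R} {u' : S}
    (hu : u ∉ 𝔭.asIdeal) (hu' : u' ∉ 𝔓.asIdeal)
    (hι : ∀ y, ι y = 0 → u • y = 0) (hc : ∀ x, c x = 0 → u • x = 0)
    (hcj : ∀ x, u' • j (c x) = 0) (hjk : ∀ x, k x = 0 → ∃ y, j y = u' • x) (z : H) :
    lengthAt S X 𝔓 + lengthAt R (H ⧸ Submodule.span R {z}) 𝔭 ≤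
      lengthAt S Y 𝔓 + lengthAt R (R ⧸ Ideal.span {ι (c z)}) 𝔭 := by
  haveI : RingHomSurjective (σ : R →+* S) := ⟨σ.surjective⟩
  -- `j` as a `σ`-semilinear map
  let j' : P →ₛₗ[(σ : R →+* S)] X := { toFun := j, map_add' := j.map_add, map_smul' := hj }
  have hj' : ∀ y, j' y = j y := fun _ ↦ rfl
  set N : Submodule R H := Submodule.span R {z} with hN
  -- (A) cover up to `u'`
  have hA : lengthAt S X 𝔓 ≤ lengthAt S (LinearMap.range j') 𝔓 + lengthAt S Y 𝔓 :=
    lengthAt_le_add_of_smul_ker_le k (LinearMap.range j') 𝔓 hu' fun x hx ↦ by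
      obtain ⟨y, hy⟩ := hjk x hx
      exact ⟨y, hy⟩
  -- (B1) transport: `ℓ_𝔓(range j) = ℓ_𝔭(P/ker j)`
  have hB1 : lengthAt S (LinearMap.range j') 𝔓 = lengthAt R (P ⧸ LinearMap.ker j') 𝔭 := by
    have hmem : ∀ q, (LinearMap.ker j').liftQ j' le_rfl q ∈ LinearMap.range j' := fun q ↦ by
      rw [← Submodule.range_liftQ (LinearMap.ker j') j' le_rfl]
      exact LinearMap.mem_range_self _ q
    let φ : (P ⧸ LinearMap.ker j') →ₛₗ[(σ : R →+* S)] LinearMap.range j' :=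
      LinearMap.codRestrict (LinearMap.range j') ((LinearMap.ker j').liftQ j' le_rfl) hmem
    have hinj : Function.Injective φ := by
      intro q q' hqq'
      have h1 : (LinearMap.ker j').liftQ j' le_rfl q = (LinearMap.ker j').liftQ j' le_rfl q' :=
        congrArg Subtype.val hqq'
      exact LinearMap.ker_eq_bot.mp (Submodule.ker_liftQ_eq_bot' _ _ rfl) h1
    have hsurj : Function.Surjective φ := by
      rintro ⟨_, y, rfl⟩
      exact ⟨Submodule.Quotient.mk y, Subtype.ext (Submodule.liftQ_apply _ _ y)⟩
    let e : (P ⧸ LinearMap.ker j') ≃+ LinearMap.range j' := AddEquiv.ofBijective φ.toAddMonoidHom ⟨hinj, hsurj⟩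
    have he : ∀ (r : R) (q : P ⧸ LinearMap.ker j'), e (r • q) = σ r • e q := fun r q ↦ φ.map_smulₛₗ r q
    exact (SemilinearTransport.lengthAt_eq σ e he h𝔭).symm
  -- (B2) reciprocity up to `u'`: `σ⁻¹(u') · range c ⊆ ker j`
  have hB2 : lengthAt R (P ⧸ LinearMap.ker j') 𝔭 ≤ lengthAt R (P ⧸ LinearMap.range c) 𝔭 := by
    refine lengthAt_quotient_le_of_smul_mem 𝔭 (c := σ.symm u') (fun h ↦ hu' ?_) ?_
    · rw [h𝔭, Ideal.mem_comap, σ.apply_symm_apply] at h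
      exact h
    · rintro _ ⟨x, rfl⟩
      rw [LinearMap.mem_ker, hj', hj, σ.apply_symm_apply]
      exact hcj x
  -- (C)+(D): the un-twisted robust road with `X := P/range c`, `Y := 0`
  have hCD : lengthAt R (P ⧸ LinearMap.range c) 𝔭 + lengthAt R (H ⧸ N) 𝔭 ≤
      lengthAt R (R ⧸ Ideal.span {ι (c z)}) 𝔭 := by
    have h := fourTerm_lengthAt_le_upTo ι c (LinearMap.range c).mkQ
      (0 : (P ⧸ LinearMap.range c) →ₗ[R] (⊥ : Submodule R P)) 𝔭 hu hι hc
      (fun x ↦ by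
        rw [Submodule.mkQ_apply, ← Submodule.Quotient.mk_smul, Submodule.Quotient.mk_eq_zero]
        exact Submodule.smul_mem _ u (LinearMap.mem_range_self c x))
      (fun x _ ↦ by rw [Submodule.range_mkQ]; exact Submodule.mem_top) z
    rwa [lengthAt_eq_zero_of_subsingleton (M := (⊥ : Submodule R P)) 𝔭, zero_add] at h
  calc lengthAt S X 𝔓 + lengthAt R (H ⧸ N) 𝔭
      ≤ (lengthAt R (P ⧸ LinearMap.range c) 𝔭 + lengthAt S Y 𝔓) + lengthAt R (H ⧸ N) 𝔭 :=
        add_le_add (hA.trans (add_le_add ((le_of_eq hB1).trans hB2) le_rfl)) le_rfl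
    _ = lengthAt S Y 𝔓 + (lengthAt R (P ⧸ LinearMap.range c) 𝔭 + lengthAt R (H ⧸ N) 𝔭) := by ring
    _ ≤ lengthAt S Y 𝔓 + lengthAt R (R ⧸ Ideal.span {ι (c z)}) 𝔭 := add_le_add le_rfl hCD

end Semilinear

/-! ## §2 The registered stub `stub_involChainTwo` (CHAIN^ι) -/

section Chain

/-- **stub (CHAIN^ι) of line `colemanrat` v5 — (K2^ι) → GZK → (R2^ι) → K3's local form off `2`.** Granted
(K2^ι) Kato Thm. 13.4 (2) at `p = 2` print-exact (`ℓ_𝔭(Y.X) ≤ ℓ_{ι𝔭}(𝐇¹/Λs)` for genuine non-zero `2`-adic Euler-system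
classes, `ι𝔭 = comap ι 𝔭`), (GZK) `rank = r_an` for `r_an ≤ 1`, and (R2^ι) at every place `v ∋ 2`: per habitat datum, dual
datum `D` (torsion) and height-one `𝔭 ∌ 2` the `ι`-repaired localised `2`-robust package (`I`, `P`, `Λ`-linear `ι_P`, `col`,
ADDITIVE `ι`-SEMILINEAR `j`, genuine class `s`, exponent `m`; (Col), (Rec), (LocCover) at the prime of `ℚ_∞` above `2`, zeta
bound at `𝔭`) — then for every habitat datum, torsion `D` and height-one `𝔭 ∌ 2`: `ℓ_𝔭(X⁺) ≤ ℓ_𝔭(Λ/(L♭))`. Road: take the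
place `v₂` of `ℚ` above `2` and the package AT `ι𝔭` (height one, `∌ C 2`: `IwasawaInvolution.height_comap_invol`,
`C_mem_comap_invol_iff`); `L♭ ≠ 0 ⇒ ι_P col s ≠ 0 ⇒ s ≠ 0`, `col`
injective (`injective_col_of_gzk'`), `ℓ_{ι𝔭}(𝐇¹/Λs) < ⊤` (`lengthAt_quotient_span_ne_top_of_gzk`); canonical fine dual
`Y` and kernel-built `k : X⁺ ↠ X₀` (`FineRestriction.exists_fineRestrict_package`), its kernel covered with exponent
`m + 1` through the fine sandwich and the ONE-place local cover (`FineSandwich.toDual_two_nsmul_apply_eq_zero`,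
`FineStrictRat.localCover_of_localCover_resOfLe_rat`); §1 with `σ = ι`, `u = u' = C(2)^{m+1}`:
`ℓ_𝔭(X⁺) + ℓ_{ι𝔭}(𝐇¹/Λs) ≤ ℓ_𝔭(X₀) + ℓ_{ι𝔭}(Λ/(ι_P col s))`; (K2^ι) at `𝔭`, the zeta bound at `ι𝔭`, the functional
equation `ℓ_{ι𝔭}(Λ/(L♭)) = ℓ_𝔭(Λ/(L♭))` (`IwasawaInvolution.lengthAt_quotient_kobayashiL_comap_invol_eq`); cancel the finite
`ℓ_{ι𝔭}(𝐇¹/Λs)`. The structure facts of `T₂E` are discharged by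
`TateModule.continuousSMul_padicInt`, `module_free_tateModule_holds`, `module_finite_tateModule_holds`.
[cite: Kobayashi2003, (7.17)–(7.21), Thm. 7.3 (pp. 12–13)] [cite: Kato2004Asterisque, Thm. 13.4 (2) (p. 226), §17.13 (p. 279)]
[cite: MazurTateTeitelbaum1986Invent, Ch. I §17] [cite: GreenbergLNM1716, §1 p. 60] [cite: Sprung2017, Cor. 4.14] -/
theorem stub_involChainTwo :
    (∀ (W : WeierstrassCurve ℚ) [W.IsElliptic], ¬ W.HasCM →
      ∀ [ContinuousSMul ℤ_[2] (W.tateModule 2)] [Module.Free ℤ_[2] (W.tateModule 2)]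
        [Module.Finite ℤ_[2] (W.tateModule 2)]
        (κ : ZpExtension ℚ 2) (γ : Field.absoluteGaloisGroup ℚ) (hκ : κ.IsCyclotomic), κ.IsTopGenerator γ →
      ∀ (I : Kato2004.IwasawaH1Data W 2 κ γ) (Y : W.FineSelmerDualData κ γ) (s : I.H),
        (∃ (S : Set (HeightOneSpectrum (𝓞 ℚ))) (_ : S.Finite)
            (z : ∀ (k : ℕ) (r : (cyclotomicLevelsRat 2 S).Ideals),
              H1 (tateRep W 2) ((cyclotomicLevelsRat 2 S).level k r.1)),
            IsEulerSystem (cyclotomicLevelsRat 2 S) (tateRep W 2) 2 z ∧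
            (∀ (k : ℕ) (r : (cyclotomicLevelsRat 2 S).Ideals),
              z k r ∈ integralH1 (tateRep W 2) 2 ((cyclotomicLevelsRat 2 S).level k r.1)) ∧
            ∀ n : ℕ, I.proj n s =
              Kato2004.levelToLayerTwo W hκ S n (z (n + 2) (cyclotomicLevelsRat 2 S).idealOne)) →
        s ≠ 0 →
        ∀ 𝔭 : PrimeSpectrum (IwasawaAlgebra 2), 𝔭.asIdeal.height = 1 →
          PowerSeries.C (2 : ℤ_[2]) ∉ 𝔭.asIdeal →
          lengthAt (IwasawaAlgebra 2) Y.X 𝔭 ≤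
            lengthAt (IwasawaAlgebra 2) (I.H ⧸ Submodule.span (IwasawaAlgebra 2) {s})
              (PrimeSpectrum.comap (IwasawaAlgebra.invol 2).toRingHom 𝔭)) →
    rank_eq_analyticRank_of_analyticRank_le_one →
    (∀ (v : HeightOneSpectrum (𝓞 ℚ)), ((2 : ℕ) : 𝓞 ℚ) ∈ v.asIdeal →
    ∀ (W : WeierstrassCurve ℚ) [W.IsElliptic] [W.IsGloballyMinimal],
      ¬ W.HasCM → W.analyticRank = 0 → GoodSS W 2 → W.frobeniusTrace 2 = 0 →
      ∀ (κ : ZpExtension ℚ 2) (γ : Field.absoluteGaloisGroup ℚ) (hκ : κ.IsCyclotomic),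
        κ.IsTopGenerator γ → IsCyclotomicVariable 2 γ →
        ∀ [NeZero (W.conductorNorm ℤ)] (f : CuspForm (Gamma0 (W.conductorNorm ℤ)) 2),
          IsNewformOf W f → ∀ (ϖ : ℚ), (ϖ : ℝ) * W.realPeriodRat = plusPeriod f →
        ∀ (Lplus Lminus : IwasawaAlgebra 2), IsPollackPair f 2 Lplus Lminus →
        ∀ (D : SignedSelmerDualData W κ γ 1) [ContinuousSMul ℤ_[2] (W.tateModule 2)]
          [Module.Free ℤ_[2] (W.tateModule 2)] [Module.Finite ℤ_[2] (W.tateModule 2)],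
          Module.IsTorsion (IwasawaAlgebra 2) D.X →
          ∀ 𝔭 : PrimeSpectrum (IwasawaAlgebra 2), 𝔭.asIdeal.height = 1 →
            PowerSeries.C (2 : ℤ_[2]) ∉ 𝔭.asIdeal →
          ∃ (I : Kato2004.IwasawaH1Data W 2 κ γ)
            (P : Type) (_ : AddCommGroup P) (_ : _root_.Module (IwasawaAlgebra 2) P)
            (ι : P →ₗ[IwasawaAlgebra 2] IwasawaAlgebra 2) (col : I.H →ₗ[IwasawaAlgebra 2] P)
            (j : P →+ D.X) (s : I.H) (m : ℕ),
            (∀ (g : IwasawaAlgebra 2) (y : P), j (g • y) = IwasawaAlgebra.invol 2 g • j y) ∧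
            (∀ y, ι y = 0 → (PowerSeries.C (2 : ℤ_[2]) : IwasawaAlgebra 2) ^ m • y = 0) ∧
            (∀ x, (PowerSeries.C (2 : ℤ_[2]) : IwasawaAlgebra 2) ^ m • j (col x) = 0) ∧
            (∀ x : D.X,
              (∀ t : signedSelmerInfty W κ 1,
                resOfLe (W.geomPrimaryTorsion 2) (inf_le_left : κ.kerSubgroup ⊓ decomp v ≤ κ.kerSubgroup)
                  (t : W.subgroupH1 2 κ.kerSubgroup) = 0 → D.toDual x t = 0) →
              ∃ y : P, j y = (PowerSeries.C (2 : ℤ_[2]) : IwasawaAlgebra 2) ^ m • x) ∧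
            Kato2004.IsEulerSystemClassTwo W hκ I s ∧
            lengthAt (IwasawaAlgebra 2) (IwasawaAlgebra 2 ⧸ Ideal.span {ι (col s)}) 𝔭 ≤
              lengthAt (IwasawaAlgebra 2) (IwasawaAlgebra 2 ⧸ Ideal.span {kobayashiL 1 Lplus Lminus}) 𝔭) →
    (∀ (W : WeierstrassCurve ℚ) [W.IsElliptic] [W.IsGloballyMinimal],
      ¬ W.HasCM → W.analyticRank = 0 → GoodSS W 2 → W.frobeniusTrace 2 = 0 →
      ∀ (κ : ZpExtension ℚ 2) (γ : Field.absoluteGaloisGroup ℚ),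
        κ.IsCyclotomic → κ.IsTopGenerator γ → IsCyclotomicVariable 2 γ →
        ∀ [NeZero (W.conductorNorm ℤ)] (f : CuspForm (Gamma0 (W.conductorNorm ℤ)) 2),
          IsNewformOf W f → ∀ (ϖ : ℚ), (ϖ : ℝ) * W.realPeriodRat = plusPeriod f →
        ∀ (Lplus Lminus : IwasawaAlgebra 2), IsPollackPair f 2 Lplus Lminus →
        ∀ (D : SignedSelmerDualData W κ γ 1), Module.IsTorsion (IwasawaAlgebra 2) D.X →
          ∀ 𝔭 : PrimeSpectrum (IwasawaAlgebra 2), 𝔭.asIdeal.height = 1 →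
            PowerSeries.C (2 : ℤ_[2]) ∉ 𝔭.asIdeal →
            lengthAt (IwasawaAlgebra 2) D.X 𝔭 ≤
              lengthAt (IwasawaAlgebra 2) (IwasawaAlgebra 2 ⧸ Ideal.span {kobayashiL 1 Lplus Lminus}) 𝔭) := by
  intro hK2 h17 hR W _ _ hcm hr hss ha κ γ hκ hγ hcv _ f hf ϖ hϖ Lplus Lminus hPP D hX 𝔭 h𝔭 hp𝔭
  haveI : ContinuousSMul ℤ_[2] (W.tateModule 2) := TateModule.continuousSMul_padicInt
  haveI : Module.Free ℤ_[2] (W.tateModule 2) := module_free_tateModule_holds W 2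
  haveI : Module.Finite ℤ_[2] (W.tateModule 2) := module_finite_tateModule_holds W 2
  -- the place of `ℚ` above `2`
  have hv : ((2 : ℕ) : 𝓞 ℚ) ∈
      ((Rat.HeightOneSpectrum.primesEquiv (R := 𝓞 ℚ)).symm ⟨2, Nat.prime_two⟩).asIdeal :=
    (natCast_mem_asIdeal_iff_eq_primesEquiv_symm _ Nat.prime_two).mpr rfl
  -- the involution as a ring automorphism, and the twisted prime `𝔮 = ι𝔭`
  let ιe : IwasawaAlgebra 2 ≃+* IwasawaAlgebra 2 := (IwasawaAlgebra.involEquiv 2 : IwasawaAlgebra 2 ≃+* IwasawaAlgebra 2)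
  set 𝔮 : PrimeSpectrum (IwasawaAlgebra 2) := PrimeSpectrum.comap (IwasawaAlgebra.invol 2).toRingHom 𝔭 with h𝔮def
  have h𝔮𝔭 : 𝔮.asIdeal = 𝔭.asIdeal.comap ιe := IwasawaInvolution.ideal_comap_invol_toRingHom 2 𝔭.asIdeal
  have h𝔮 : 𝔮.asIdeal.height = 1 := by rw [h𝔮def, IwasawaInvolution.height_comap_invol, h𝔭]
  have hp𝔮 : PowerSeries.C (2 : ℤ_[2]) ∉ 𝔮.asIdeal := fun h ↦
    hp𝔭 ((IwasawaInvolution.C_mem_comap_invol_iff 2 (2 : ℤ_[2]) 𝔭).mp h)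
  -- the ι-repaired package AT `𝔮`
  obtain ⟨I, P, _, _, ιP, col, j, s, m, hj, hι, hcj, hloc, hES, hdiv⟩ :=
    hR _ hv W hcm hr hss ha κ γ hκ hγ hcv f hf ϖ hϖ Lplus Lminus hPP D hX 𝔮 h𝔮 hp𝔮
  have hL : kobayashiL 1 Lplus Lminus ≠ 0 := by rw [kobayashiL, if_pos rfl]; exact hPP.2.1
  have hcs : ιP (col s) ≠ 0 := ne_zero_of_lengthAt_quotient_span_le hL 𝔮 h𝔮 hdiv
  have hs0 : s ≠ 0 := by
    rintro rfl
    exact hcs (by rw [map_zero, map_zero])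
  have hinj := injective_col_of_gzk' h17 hr hκ hγ I ιP col hcs
  have hfin := lengthAt_quotient_span_ne_top_of_gzk h17 hr hκ hγ I hs0 𝔮 (le_of_eq h𝔮)
  -- the canonical fine dual and the kernel-built restriction `k : X⁺ ↠ X₀`
  let Y : W.FineSelmerDualData κ γ := W.fineSelmerDualData κ hγ
  obtain ⟨k, -, -, hkker, -⟩ := FineRestriction.exists_fineRestrict_package W κ hγ D Y
  -- (K2^ι) at `𝔭`: `ℓ_𝔭(X₀) ≤ ℓ_𝔮(𝐇¹/Λs)`
  have hK := hK2 W hcm κ γ hκ hγ I Y s ((Kato2004.isEulerSystemClassTwo_iff W hκ I s).mp hES) hs0 𝔭 h𝔭 hp𝔭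
  have hu𝔮 : (PowerSeries.C (2 : ℤ_[2]) : IwasawaAlgebra 2) ^ (m + 1) ∉ 𝔮.asIdeal :=
    pow_not_mem_of_not_mem 𝔮 hp𝔮 (m + 1)
  have hu𝔭 : (PowerSeries.C (2 : ℤ_[2]) : IwasawaAlgebra 2) ^ (m + 1) ∉ 𝔭.asIdeal :=
    pow_not_mem_of_not_mem 𝔭 hp𝔭 (m + 1)
  -- cover of `ker k` with exponent `m + 1`: fine sandwich + (LocCover) at the prime of `ℚ_∞` above `2`, at `2 • x`
  have hjk : ∀ x : D.X, k x = 0 →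
      ∃ y : P, j y = (PowerSeries.C (2 : ℤ_[2]) : IwasawaAlgebra 2) ^ (m + 1) • x := by
    intro x hxk
    rw [C_two_pow_succ_smul]
    refine FineStrictRat.localCover_of_localCover_resOfLe_rat W κ 1 hκ _ hv D (2 • x) (hloc (2 • x))
      fun t ht ↦ ?_
    exact FineSandwich.toDual_two_nsmul_apply_eq_zero W κ 1 D x ((hkker x).1 hxk) t ht
  -- §1 with `σ = ι`, `R`-side prime `𝔮`, `S`-side prime `𝔭`
  have h4 := fourTerm_lengthAt_le_upTo_semilinear ιe h𝔮𝔭 ιP col j (fun g y ↦ hj g y) k hu𝔮 hu𝔭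
    (fun y hy ↦ C_two_pow_succ_smul_eq_zero (hι y hy))
    (fun x hx ↦ by rw [hinj (hx.trans (map_zero col).symm), smul_zero])
    (fun x ↦ C_two_pow_succ_smul_eq_zero (hcj x)) hjk s
  -- the zeta bound at `𝔮`, the functional equation, and cancellation of the finite `ℓ_𝔮(𝐇¹/Λs)`
  have hFE := IwasawaInvolution.lengthAt_quotient_kobayashiL_comap_invol_eq hf hss ha hPP 𝔭
  have h : lengthAt (IwasawaAlgebra 2) D.X 𝔭 +
        lengthAt (IwasawaAlgebra 2) (I.H ⧸ Submodule.span (IwasawaAlgebra 2) {s}) 𝔮 ≤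
      lengthAt (IwasawaAlgebra 2) (IwasawaAlgebra 2 ⧸ Ideal.span {kobayashiL 1 Lplus Lminus}) 𝔭 +
        lengthAt (IwasawaAlgebra 2) (I.H ⧸ Submodule.span (IwasawaAlgebra 2) {s}) 𝔮 :=
    h4.trans ((add_le_add hK (hdiv.trans (le_of_eq hFE))).trans (le_of_eq (add_comm _ _)))
  exact (WithTop.add_le_add_iff_right hfin).mp h

end Chain

end SignedKatoOffTwo

end Summit.BirchSwinnertonDyer.BirchSwinnertonDyer.Theorems

end
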